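import Literature.Computability.AlgebraicComplexity.DeterminantalIdealComplexityProofs

/-!
# Stub `stub_andrewsLeadingBlock` of crux `CondensationDistance.DerivationsBoundOmega`
# (stmt-MatrixMultiplication-15940), line `birth`

Andrews' lifting theorem (R. Andrews, *On Matrix Multiplication and Polynomial Identity Testing*,
FOCS 2022, Thm. 3) for nonzero multiples of the leading minor: for the generic `4t × m'` matrix `Z`
(`4t ≤ m'`), its leading `4t × 4t` block `X` (columns `Fin.castLE h`), and any nonzero `q ∈ ℂ[Z]`,
the algebraic border rank (`algBorderRank`) of the matrix multiplication tensor `⟨t,t,t⟩`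
(`matMulTensor`) is at most `6 · complexity (q · det X)`.

Proof: `det X` is the `4t × 4t` minor `det (Z.submatrix id (Fin.castLE h))` of the generic matrix
`Z = Matrix.mvPolynomialX`, so `q · det X ∈ I^det_{4t,m',4t}` (`det_submatrix_mem_detIdeal`,
`Ideal.mul_mem_left`); it is nonzero since `ℂ[Z]` is a domain and `X` is the image of the generic
square matrix under the injective renaming `Prod.map id (Fin.castLE h)`
(`Matrix.det_mvPolynomialX_ne_zero`, `MvPolynomial.rename_injective`). Andrews' Thm. 3, DISCHARGED in
the tree as `Andrews2022_thm3_holds` (DeterminantalIdealComplexityProofs.lean), at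
`(F, n, m, r) = (ℂ, 4t, m', 4t)` gives `bR(⟨4t/4, 4t/4, 4t/4⟩) ≤ 6 · complexity (q · det X)`, and
`4t/4 = t`.

Target tree file:
`Summits/MatrixMultiplication/MatrixMultiplication/Theorems/CondensationDistanceDerivationsBoundOmegaStubAndrewsLeadingBlock.lean`
(helper for the crux, landed with `--supports stmt-MatrixMultiplication-15940`); the theorem keeps
EXACTLY the registered name and signature of the skeleton `Cruxes/DerivationsBoundOmega/Lines/birth.lean`.

## References
* [Andrews2022] R. Andrews, On Matrix Multiplication and Polynomial Identity Testing, FOCS 2022,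
  arXiv:2208.01078; SIAM J. Comput. (2024) doi:10.1137/22m1536169 — Thm. 3.
-/

set_option linter.dupNamespace false

namespace Summit.MatrixMultiplication.MatrixMultiplication.Theorems.DerivationsBoundOmega

open Literature.Computability.AlgebraicComplexity

/-- A square block of the generic `n × m'` matrix on an injective column selection `g` has nonzero
determinant: it is the image of the generic square matrix `Matrix.mvPolynomialX (Fin n) (Fin n) ℂ`
under the injective renaming `Prod.map id g`. [folklore] -/
private theorem det_X_comp_ne_zero {n m' : ℕ} (g : Fin n → Fin m') (hg : Function.Injective g) :
    (Matrix.of fun i j : Fin n =>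
        (MvPolynomial.X (i, g j) : MvPolynomial (Fin n × Fin m') ℂ)).det ≠ 0 := by
  have hρ : Function.Injective (Prod.map id g : Fin n × Fin n → Fin n × Fin m') :=
    Function.injective_id.prodMap hg
  have hM : (Matrix.of fun i j : Fin n =>
        (MvPolynomial.X (i, g j) : MvPolynomial (Fin n × Fin m') ℂ)) =
      (MvPolynomial.rename (Prod.map id g : Fin n × Fin n → Fin n × Fin m')).toRingHom.mapMatrix
        (Matrix.mvPolynomialX (Fin n) (Fin n) ℂ) := by
    ext i j
    simp [Matrix.mvPolynomialX_apply, MvPolynomial.rename_X]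
  rw [hM, ← RingHom.map_det]
  intro h
  exact Matrix.det_mvPolynomialX_ne_zero (Fin n) ℂ
    (MvPolynomial.rename_injective _ hρ (by rw [map_zero]; exact h))

/-- **Andrews' lifting theorem for nonzero multiples of the leading minor** (Andrews 2022, Thm. 3,
at `(F, n, m, r) = (ℂ, 4t, m', 4t)`): for the generic `4t × m'` matrix `Z` (`4t ≤ m'`), its leading
`4t × 4t` block `X`, and any nonzero `q ∈ ℂ[Z]`, the algebraic border rank of `⟨t,t,t⟩` is at most
`6 · complexity (q · det X)` — `q · det X` is a nonzero member of `I^det_{4t,m',4t}` and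
`Andrews2022_thm3_holds` applies; `4t/4 = t`. Registered stub `stub_andrewsLeadingBlock` of line
`birth` of crux `DerivationsBoundOmega`. [cite: Andrews2022, Thm. 3] -/
theorem stub_andrewsLeadingBlock :
    ∀ (t m' : ℕ) (h : 4 * t ≤ m') (q : MvPolynomial (Fin (4 * t) × Fin m') ℂ), q ≠ 0 →
      algBorderRank (matMulTensor ℂ t t t) ≤
        6 * complexity (q * Matrix.det (Matrix.of fun i j : Fin (4 * t) => MvPolynomial.X (i, Fin.castLE h j))) := by
  intro t m' h q hq
  -- `X` is the `4t × 4t` minor of the generic matrix on the columns `Fin.castLE h`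
  have hX : (Matrix.mvPolynomialX (Fin (4 * t)) (Fin m') ℂ).submatrix id (Fin.castLE h) =
      Matrix.of fun i j : Fin (4 * t) => MvPolynomial.X (i, Fin.castLE h j) := by
    ext i j
    simp [Matrix.mvPolynomialX_apply]
  have hmem : q * Matrix.det (Matrix.of fun i j : Fin (4 * t) => MvPolynomial.X (i, Fin.castLE h j)) ∈
      detIdeal ℂ (4 * t) m' (4 * t) := by
    refine Ideal.mul_mem_left _ q ?_
    have hmin := det_submatrix_mem_detIdeal (F := ℂ) (n := 4 * t) (m := m') (r := 4 * t)
      id (Fin.castLE h)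
    rwa [hX] at hmin
  have hne :
      q * Matrix.det (Matrix.of fun i j : Fin (4 * t) => MvPolynomial.X (i, Fin.castLE h j)) ≠ 0 :=
    mul_ne_zero hq (det_X_comp_ne_zero (Fin.castLE h) (Fin.castLE_injective h))
  have hA := Andrews2022_thm3_holds ℂ (4 * t) m' (4 * t) _ hmem hne
  have h4 : 4 * t / 4 = t := by omega
  rw [h4] at hA
  exact hA

end Summit.MatrixMultiplication.MatrixMultiplication.Theorems.DerivationsBoundOmega
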